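/-
Copyright: statement-level skeleton of a published paper (lit-balaban cell, Phase-2 proof seat p18, gen 7). No claims beyond
what the kernel checks below.
-/
import Mathlib
import Literature.MathematicalPhysics.QuantumFieldTheory.Balaban1983to89.B3FreeLineSingle
import Literature.MathematicalPhysics.QuantumFieldTheory.Balaban1983to89.B3Prop22FreeLines

/-!
# B3 — T. Bałaban, *(Higgs)₂,₃ quantum fields in a finite volume. III. Renormalization*, CMP **88** (1983) 411–445
[Balaban1983Higgs3] — **Proposition 2.2** p. 428 (Proposition 2.1 WITH the (2.4) exception for the generalized graphs) AT THE
PRINT'S STRENGTH of the integration-by-parts hypotheses: r15's `B3Prop1.Prop22` INHABITED for the family of multi-graph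
expansions of the print-strength IBP-ready amplitudes over the generalized graphs with menu-valued free line exponents

statement-level skeleton of published theorems with citation tags; proofs where landed; nothing here is a claim about
the Yang–Mills mass gap

PDF held: `paper:balaban1983-higgs-2-3-quantum-fields-finite-volume` (journal page = PDF page + 410).

Part of the Phase-2 work on SKELETON row **B3.Prop2.2** (unit `lit-balaban-p18` gen 7, HOME `run/shared/lean/pub/lit-balaban/`):
the print-strength companion of `B3Prop22FreeLines` (`prop22_freeLines`, p299768), on `B3FreeLineSingle` (`IBPAmpK₁`); the
κ ≡ 0 twin is seat p19 gen 5's `B3Prop21Except24Single` (`IBPAmp₁`), followed line by line.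

WHAT IS REPRODUCED.  Proposition 2.2 p. 428 [PDF 18], verbatim: *"Proposition 2.1 holds for the described above generalized
expressions and graphs"* (vertices with arbitrary numbers of legs and powers of η, *"lines with the same exponential factors but
with arbitrary dimensions instead of −d+2"*, propagators with (2.6) and (2.10)–(2.12)); Proposition 2.1 p. 424 with its
exception *"with the possible exception of the subgraphs (2.4)"*; (2.16) p. 428 *"O(1) depends on δ_i, n̄ only"*.
KERNEL-CHECKED HERE, for the print-strength IBP-ready amplitudes `IBPAmpK₁ G κ` over `Counts.toModelK G κ` (one derivative
leg per vertex, the derivative budget (2.10) only where (2.8) can put a difference) with extra exponents from a finite menu: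
**(1.33) for the sum with fixed ordering l̃** when every component of the `G_i` along l̃ has positive degree OR is a (2.4)-block
of the generalized graph (`IBPAmpK₁.sum_abs_E_le_ordering`), **(1.33) for the total amplitude** (`IBPAmpK₁.abs_EtotM_le`) and
its graph-UNIFORM form `|E(G′)| ≤ unifO1K P mb · prefM` for amplitudes with the family constants (`IBPAmpK₁.abs_EtotM_le_unifO1K`
— the inequality any family of such amplitudes assembles into r15's `Prop21`, e.g. a generalized zero-field box family through
the bridge `IBPAmp₁.toK₁` of `B3FreeLineSingle`); the family **`famK₁ P mbar`** of multi-graph expansions (graphs `CGraphK₁` =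
connected count data WITH AT MOST ONE DERIVATIVE LEG PER VERTEX (the vertices (1.6)–(1.15); a property of the graph) + menu-valued
κ as in `B3Prop22FreeLines`; datum = a print-strength amplitude for every such generalized graph and localization; `subDeg :=
degQK`, `Is24 := Is24K`), its non-vacuity (`DatumK₁.zero` — unlike a datum asked to serve graphs violating `single`, which would
be empty), and **`prop22_freeLines₁ : B3Prop1.Prop22
(famK₁ P mbar)`** (+ `prop21_freeLines₁`) with ONE constant `O(1)(n̄) = unifO1K P (mbar n̄)`.  HONEST SCOPE as in
`B3Prop22FreeLines`: analytic inputs = fields of the class (now at exactly the printed strength); "arbitrary dimensions" =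
shifts from the fixed finite menu `P.menu ⊂ ℚ` (GAPS G-B3-13).
-/

open Finset

namespace Literature.MathematicalPhysics.QuantumFieldTheory.Balaban1983to89

namespace B3Ineq213

open B3Ineq215 B3FreeLine B3Sect2FirstEstimate B3Prop1

variable {V : Type} [Fintype V] [DecidableEq V] {m : ℕ}

namespace IBPAmpK₁

variable {G : Counts V m} {κ : Fin m → ℚ}

/-! ## (1.33) for the sum with fixed ordering, print-strength readiness -/

/-- **(1.33) for the sum with fixed ordering l̃ over the generalized graphs, with the (2.4) exception, print-strength readiness**:
extra exponents from the menu `T`, every component along σ of positive degree OR a (2.4)-block of the generalized graph ⇒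
`Σ_{j∈J(l̃)} |E(G(j), {□(v)}, Φ′, A)| ≤ #{G′∗} · (Π_l C_l)(1+e^{δ₁})^{2m} · unifConst215K(d, L, m, δ₁, Dmin T m) · cD^m · prefM`.
[cite: Balaban1983Higgs3, Prop. 2.2 p.428] -/
theorem sum_abs_E_le_ordering (A : IBPAmpK₁ G κ) {T : Finset ℚ} (hκ : ∀ l, κ l ∈ T) (𝒜 : B3.Assignment m A.k)
    (σ : Equiv.Perm (Fin m))
    (hyp : ∀ i, i ≤ m → ∀ b ∈ ((relabelCounts G σ).toModelK (κ ∘ σ)).reps i,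
      ((relabelCounts G σ).toModelK (κ ∘ σ)).Nontriv i b →
      Is24K (relabelCounts G σ) (κ ∘ σ) i b ∨ 0 < ((relabelCounts G σ).toModelK (κ ∘ σ)).D i b) :
    ∑ j ∈ 𝒜.J σ, |A.E (fun l => ((j l : Fin A.k) : ℕ))|
      ≤ ((choices (relabelCounts G σ).src (relabelCounts G σ).tgt (sites (relabelCounts G σ))).card : ℝ)
        * (((∏ l, A.C l) * ((1 + Esh (G.toModelK κ)) ^ 2) ^ m) * unifConst215K G.d G.L m G.δ₁ ((Dmin T m : ℚ) : ℝ)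
          * (A.cD ^ m * A.toAmp.prefM)) := by
  classical
  set Gs := relabelCounts G σ with hGs
  set As : IBPAmpK₁ Gs (κ ∘ σ) := A.relabel σ with hAs
  set S := sites Gs with hSdef
  have hSsub : S ⊆ sites Gs := subset_refl _
  have hκs : ∀ i, (κ ∘ σ) i ∈ T := fun i => hκ (σ i)
  have hmem : ∀ j ∈ 𝒜.J σ, (fun i => ((j (σ i) : Fin A.k) : ℕ)) ∈ Model.Mon m A.k :=
    fun j hj => Model.mem_Mon_of_orderedAlong (𝒜.ordered σ j hj)
  have hinj : Set.InjOn (fun (j : Fin m → Fin A.k) (i : Fin m) => ((j (σ i) : Fin A.k) : ℕ)) ↑(𝒜.J σ) := by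
    intro j _ j' _ h
    funext l
    have e := congrFun h (σ.symm l)
    simp only [Equiv.apply_symm_apply] at e
    exact Fin.ext e
  have hU0 : 0 ≤ unifConst215K G.d G.L m G.δ₁ ((Dmin T m : ℚ) : ℝ) :=
    (unifConst215K_pos G.d_pos G.two_le_L m G.δ₁_pos (by exact_mod_cast Dmin_pos T m)).le
  have hterm : ∀ c : {c // c ∈ choices Gs.src Gs.tgt S},
      ∑ j' ∈ Model.Mon m A.k, |(As.term hSsub c.2).E j'|
        ≤ ((∏ l, A.C l) * ((1 + Esh (G.toModelK κ)) ^ 2) ^ m) * unifConst215K G.d G.L m G.δ₁ ((Dmin T m : ℚ) : ℝ)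
          * (A.cD ^ m * A.toAmp.prefM) := by
    intro c
    set Tc := As.term hSsub c.2 with hTc
    have hpos := posK_moveCounts Gs (κ ∘ σ) c.2 hyp
    have h213 : ∀ j' ∈ Model.Mon m A.k,
        |Tc.E j'| ≤ (∏ q, Tc.C q) * Tc.prefM * ((moveCounts Gs S c.1).toModelK (κ ∘ σ)).W 0 A.k j' Tc.box := by
      intro j' hj'
      exact Tc.abs_E_le_prefM hj'
    have hW : ∑ j' ∈ Model.Mon m A.k, ((moveCounts Gs S c.1).toModelK (κ ∘ σ)).W 0 A.k j' Tc.box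
        ≤ ((moveCounts Gs S c.1).toModelK (κ ∘ σ)).const215 :=
      ((moveCounts Gs S c.1).toModelK (κ ∘ σ)).ineq215_of_pos hpos A.k Tc.box
    have hconst : ((moveCounts Gs S c.1).toModelK (κ ∘ σ)).const215
        ≤ unifConst215K G.d G.L m G.δ₁ ((Dmin T m : ℚ) : ℝ) :=
      const215K_le (moveCounts Gs S c.1) hκs hpos
    have hC : ∏ q, Tc.C q = (∏ l, A.C l) * ((1 + Esh (G.toModelK κ)) ^ 2) ^ m := by
      rw [hTc, As.term_prod_C hSsub c.2, ← A.toAmp.prod_C_relabelK σ]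
      rfl
    have hpref : Tc.prefM ≤ A.cD ^ m * A.toAmp.prefM := As.term_prefM_le hSsub c.2
    have hC0 : 0 ≤ ∏ q, Tc.C q := prod_nonneg fun q _ => Tc.C_nonneg q
    have hP0 : 0 ≤ Tc.prefM := Tc.prefM_nonneg
    calc ∑ j' ∈ Model.Mon m A.k, |Tc.E j'|
        ≤ ∑ j' ∈ Model.Mon m A.k, (∏ q, Tc.C q) * Tc.prefM
            * ((moveCounts Gs S c.1).toModelK (κ ∘ σ)).W 0 A.k j' Tc.box := sum_le_sum h213
      _ = (∏ q, Tc.C q) * Tc.prefM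
            * ∑ j' ∈ Model.Mon m A.k, ((moveCounts Gs S c.1).toModelK (κ ∘ σ)).W 0 A.k j' Tc.box := by rw [mul_sum]
      _ ≤ (∏ q, Tc.C q) * Tc.prefM * unifConst215K G.d G.L m G.δ₁ ((Dmin T m : ℚ) : ℝ) :=
          mul_le_mul_of_nonneg_left (hW.trans hconst) (mul_nonneg hC0 hP0)
      _ ≤ (∏ q, Tc.C q) * (A.cD ^ m * A.toAmp.prefM) * unifConst215K G.d G.L m G.δ₁ ((Dmin T m : ℚ) : ℝ) :=
          mul_le_mul_of_nonneg_right (mul_le_mul_of_nonneg_left hpref hC0) hU0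
      _ = _ := by rw [hC]; ring
  calc ∑ j ∈ 𝒜.J σ, |A.E (fun l => ((j l : Fin A.k) : ℕ))|
      = ∑ j ∈ 𝒜.J σ, |As.E (fun i => ((j (σ i) : Fin A.k) : ℕ))| := by
        refine sum_congr rfl fun j _ => ?_
        rw [← A.toAmp.E_relabelK σ (fun l => ((j l : Fin A.k) : ℕ))]
        rfl
    _ ≤ ∑ j ∈ 𝒜.J σ, ∑ c ∈ (choices Gs.src Gs.tgt S).attach,
          |(As.term hSsub c.2).E (fun i => ((j (σ i) : Fin A.k) : ℕ))| := by
        refine sum_le_sum fun j _ => ?_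
        rw [As.E_eq_sum_terms hSsub]
        exact abs_sum_le_sum_abs _ _
    _ = ∑ c ∈ (choices Gs.src Gs.tgt S).attach, ∑ j ∈ 𝒜.J σ,
          |(As.term hSsub c.2).E (fun i => ((j (σ i) : Fin A.k) : ℕ))| := sum_comm
    _ ≤ ∑ c ∈ (choices Gs.src Gs.tgt S).attach, ∑ j' ∈ Model.Mon m A.k, |(As.term hSsub c.2).E j'| := by
        refine sum_le_sum fun c _ => ?_
        calc ∑ j ∈ 𝒜.J σ, |(As.term hSsub c.2).E (fun i => ((j (σ i) : Fin A.k) : ℕ))|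
            = ∑ j' ∈ (𝒜.J σ).image (fun (j : Fin m → Fin A.k) (i : Fin m) => ((j (σ i) : Fin A.k) : ℕ)),
                |(As.term hSsub c.2).E j'| := by rw [sum_image hinj]
          _ ≤ ∑ j' ∈ Model.Mon m A.k, |(As.term hSsub c.2).E j'| := by
              apply sum_le_sum_of_subset_of_nonneg
              · intro j' hj'
                obtain ⟨j, hj, rfl⟩ := mem_image.1 hj'
                exact hmem j hj
              · intro j' _ _
                exact abs_nonneg _
    _ ≤ ∑ _c ∈ (choices Gs.src Gs.tgt S).attach,
          ((∏ l, A.C l) * ((1 + Esh (G.toModelK κ)) ^ 2) ^ m) * unifConst215K G.d G.L m G.δ₁ ((Dmin T m : ℚ) : ℝ)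
            * (A.cD ^ m * A.toAmp.prefM) :=
        sum_le_sum fun c _ => hterm c
    _ = _ := by rw [sum_const, card_attach, nsmul_eq_mul]

/-- **(1.33) for the total amplitude over the generalized graph, with the (2.4) exception, print-strength readiness.**
[cite: Balaban1983Higgs3, Prop. 2.2 p.428] -/
theorem abs_EtotM_le (A : IBPAmpK₁ G κ) {T : Finset ℚ} (hκ : ∀ l, κ l ∈ T)
    (hyp : ∀ σ : Equiv.Perm (Fin m), ∀ i, i ≤ m → ∀ b ∈ ((relabelCounts G σ).toModelK (κ ∘ σ)).reps i,
      ((relabelCounts G σ).toModelK (κ ∘ σ)).Nontriv i b →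
      Is24K (relabelCounts G σ) (κ ∘ σ) i b ∨ 0 < ((relabelCounts G σ).toModelK (κ ∘ σ)).D i b) :
    |A.toAmp.EtotM| ≤ (m.factorial : ℝ) * ((m + 1) ^ m : ℕ)
      * (((∏ l, A.C l) * ((1 + Esh (G.toModelK κ)) ^ 2) ^ m) * unifConst215K G.d G.L m G.δ₁ ((Dmin T m : ℚ) : ℝ)
          * (A.cD ^ m * A.toAmp.prefM)) := by
  classical
  set B := ((∏ l, A.C l) * ((1 + Esh (G.toModelK κ)) ^ 2) ^ m) * unifConst215K G.d G.L m G.δ₁ ((Dmin T m : ℚ) : ℝ)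
    * (A.cD ^ m * A.toAmp.prefM) with hB
  have hB0 : 0 ≤ B := by
    rw [hB]
    have h1 : 0 ≤ ∏ l, A.C l := prod_nonneg fun l _ => A.C_nonneg l
    have h2 : 0 ≤ unifConst215K G.d G.L m G.δ₁ ((Dmin T m : ℚ) : ℝ) :=
      (unifConst215K_pos G.d_pos G.two_le_L m G.δ₁_pos (by exact_mod_cast Dmin_pos T m)).le
    have h3 : 0 ≤ A.cD ^ m := pow_nonneg (le_trans zero_le_one A.one_le_cD) _
    have h4 := A.toAmp.prefM_nonneg
    positivity
  rw [A.toAmp.EtotM_eq_sum_E, B3.display27 (B3.Assignment.bySort m A.k)]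
  calc |∑ σ : Equiv.Perm (Fin m), ∑ j ∈ (B3.Assignment.bySort m A.k).J σ, A.E (fun l => ((j l : Fin A.k) : ℕ))|
      ≤ ∑ σ : Equiv.Perm (Fin m), |∑ j ∈ (B3.Assignment.bySort m A.k).J σ, A.E (fun l => ((j l : Fin A.k) : ℕ))| :=
        abs_sum_le_sum_abs _ _
    _ ≤ ∑ σ : Equiv.Perm (Fin m), ∑ j ∈ (B3.Assignment.bySort m A.k).J σ, |A.E (fun l => ((j l : Fin A.k) : ℕ))| :=
        sum_le_sum fun σ _ => abs_sum_le_sum_abs _ _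
    _ ≤ ∑ σ : Equiv.Perm (Fin m), (((m + 1) ^ m : ℕ) : ℝ) * B := by
        refine sum_le_sum fun σ _ => (A.sum_abs_E_le_ordering hκ (B3.Assignment.bySort m A.k) σ (hyp σ)).trans ?_
        exact mul_le_mul_of_nonneg_right (by exact_mod_cast IBPAmpK.card_choices_relabel_le (G := G) σ) hB0
    _ = (m.factorial : ℝ) * ((m + 1) ^ m : ℕ) * B := by
        rw [sum_const, card_univ, Fintype.card_perm, Fintype.card_fin, nsmul_eq_mul, mul_assoc]

/-- **(1.33) for the total amplitude with the graph-UNIFORM constant `O(1)(n̄)`** of `B3Prop22FreeLines` (`unifO1K P mb`): for a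
print-strength IBP-ready amplitude over a generalized graph with the lattice constants of `P`, at most `mb` lines, extra exponents
from `P.menu`, kernel constants `≤ Cmax` and `cD ≤ CD`, all of whose components along every ordering have positive degree or are
(2.4)-blocks, `|E(G′)| ≤ unifO1K P mb · prefM` — the inequality every family of such amplitudes assembles into r15's `Prop21`.
[cite: Balaban1983Higgs3, (2.16) p.428] -/
theorem abs_EtotM_le_unifO1K (A : IBPAmpK₁ G κ) (P : ParamsK) {mb : ℕ} (hd : G.d = P.d) (hL : G.L = P.L)
    (hδ : G.δ₁ = P.δ₁) (hm : m ≤ mb) (hκ : ∀ l, κ l ∈ P.menu) (hCmax : ∀ l, A.C l ≤ P.Cmax) (hCD : A.cD ≤ P.CD)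
    (hyp : ∀ σ : Equiv.Perm (Fin m), ∀ i, i ≤ m → ∀ b ∈ ((relabelCounts G σ).toModelK (κ ∘ σ)).reps i,
      ((relabelCounts G σ).toModelK (κ ∘ σ)).Nontriv i b →
      Is24K (relabelCounts G σ) (κ ∘ σ) i b ∨ 0 < ((relabelCounts G σ).toModelK (κ ∘ σ)).D i b) :
    |A.toAmp.EtotM| ≤ unifO1K P mb * A.toAmp.prefM := by
  classical
  have hmain := A.abs_EtotM_le hκ hyp
  have hE : Esh (G.toModelK κ) = Real.exp (2 * (P.δ₁ / 2)) := by
    show Real.exp (2 * (G.δ₁ / 2)) = _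
    rw [hδ]
  have hC : ∏ l, A.C l ≤ |P.Cmax| ^ m := by
    calc ∏ l, A.C l ≤ ∏ _l : Fin m, |P.Cmax| :=
          prod_le_prod (fun l _ => A.C_nonneg l) fun l _ => (hCmax l).trans (le_abs_self _)
      _ = |P.Cmax| ^ m := by rw [prod_const, card_univ, Fintype.card_fin]
  have hcD : A.cD ^ m ≤ |P.CD| ^ m :=
    pow_le_pow_left₀ (le_trans zero_le_one A.one_le_cD) (hCD.trans (le_abs_self _)) _
  have hU0 : 0 ≤ unifConst215K P.d P.L m P.δ₁ ((Dmin P.menu m : ℚ) : ℝ) :=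
    (unifConst215K_pos P.d_pos P.two_le_L m P.δ₁_pos (show (0 : ℝ) < ((Dmin P.menu m : ℚ) : ℝ) by
      exact_mod_cast Dmin_pos P.menu m)).le
  have hpref : 0 ≤ A.toAmp.prefM := A.toAmp.prefM_nonneg
  have hK : (m.factorial : ℝ) * ((m + 1) ^ m : ℕ)
      * (((∏ l, A.C l) * ((1 + Esh (G.toModelK κ)) ^ 2) ^ m) * unifConst215K G.d G.L m G.δ₁ ((Dmin P.menu m : ℚ) : ℝ)
        * (A.cD ^ m * A.toAmp.prefM)) ≤ sizeTermK P m * A.toAmp.prefM := by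
    rw [hd, hL, hδ, hE]
    unfold sizeTermK
    have h1 : (∏ l, A.C l) * ((1 + Real.exp (2 * (P.δ₁ / 2))) ^ 2) ^ m
        ≤ |P.Cmax| ^ m * ((1 + Real.exp (2 * (P.δ₁ / 2))) ^ 2) ^ m :=
      mul_le_mul_of_nonneg_right hC (pow_nonneg (sq_nonneg _) _)
    have h2 : (∏ l, A.C l) * ((1 + Real.exp (2 * (P.δ₁ / 2))) ^ 2) ^ m
          * unifConst215K P.d P.L m P.δ₁ ((Dmin P.menu m : ℚ) : ℝ) * A.cD ^ m
        ≤ |P.Cmax| ^ m * ((1 + Real.exp (2 * (P.δ₁ / 2))) ^ 2) ^ m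
          * unifConst215K P.d P.L m P.δ₁ ((Dmin P.menu m : ℚ) : ℝ) * |P.CD| ^ m :=
      mul_le_mul (mul_le_mul_of_nonneg_right h1 hU0) hcD (pow_nonneg (le_trans zero_le_one A.one_le_cD) _)
        (mul_nonneg (mul_nonneg (pow_nonneg (abs_nonneg _) _) (pow_nonneg (sq_nonneg _) _)) hU0)
    have hf : 0 ≤ (m.factorial : ℝ) * ((m + 1) ^ m : ℕ) := by positivity
    calc (m.factorial : ℝ) * ((m + 1) ^ m : ℕ)
          * (((∏ l, A.C l) * ((1 + Real.exp (2 * (P.δ₁ / 2))) ^ 2) ^ m)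
            * unifConst215K P.d P.L m P.δ₁ ((Dmin P.menu m : ℚ) : ℝ) * (A.cD ^ m * A.toAmp.prefM))
        = (m.factorial : ℝ) * ((m + 1) ^ m : ℕ)
          * (((∏ l, A.C l) * ((1 + Real.exp (2 * (P.δ₁ / 2))) ^ 2) ^ m)
            * unifConst215K P.d P.L m P.δ₁ ((Dmin P.menu m : ℚ) : ℝ) * A.cD ^ m) * A.toAmp.prefM := by ring
      _ ≤ (m.factorial : ℝ) * ((m + 1) ^ m : ℕ)
          * (|P.Cmax| ^ m * ((1 + Real.exp (2 * (P.δ₁ / 2))) ^ 2) ^ m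
            * unifConst215K P.d P.L m P.δ₁ ((Dmin P.menu m : ℚ) : ℝ) * |P.CD| ^ m) * A.toAmp.prefM :=
          mul_le_mul_of_nonneg_right (mul_le_mul_of_nonneg_left h2 hf) hpref
      _ = _ := by ring
  exact (hmain.trans hK).trans (mul_le_mul_of_nonneg_right (sizeTermK_le_unifO1K P hm) hpref)

end IBPAmpK₁

end B3Ineq213

/-! ## The family of generalized graph expansions with print-strength amplitudes, and Proposition 2.2 -/

namespace B3FreeLine

open B3Ineq215 B3Ineq213 B3Sect2FirstEstimate B3Prop1

/-- **One derivative leg per vertex** — a property of the GRAPH (the vertices (1.6)–(1.15) p. 413–414: (1.8), (1.9) carry one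
leg `D^η_B̃φ′`, the others none): different lines are not both differentiated at the same vertex. [cite: Balaban1983Higgs3, (1.8) p.413] -/
def Single {W : Type} [Fintype W] [DecidableEq W] {m' : ℕ} (G : Counts W m') : Prop :=
  ∀ (v : W) (l l' : Fin m'), l ≠ l' → 1 ≤ G.diffOn v l → G.diffOn v l' = 0

/-- **The generalized graphs of Proposition 2.2 with one derivative leg per vertex**: `CGraphK` (connected count datum + menu-valued
extra exponents) whose count datum is `Single`. [cite: Balaban1983Higgs3, Prop. 2.2 p.428] -/
structure CGraphK₁ (P : ParamsK) (mb : ℕ) extends CGraphK P mb where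
  /-- at most one derivative leg per vertex -/
  single : Single G

/-- A generalized graph of `CGraphK` with the one-derivative-leg property is one of `CGraphK₁`. [cite: Balaban1983Higgs3, Prop. 2.2 p.428] -/
def CGraphK₁.ofK {P : ParamsK} {mb : ℕ} (G : CGraphK P mb) (hs : Single G.G) : CGraphK₁ P mb where
  toCGraphK := G
  single := hs

/-- The analytic datum of one expansion, print-strength: `k`, the running couplings, and for every generalized graph (connected
count datum + menu-valued extra exponents) AND localization a PRINT-STRENGTH IBP-ready amplitude over it (constants `≤ Cmax`,
`cD ≤ CD`; orders independent of the localization). [cite: Balaban1983Higgs3, Prop. 2.2 p.428] -/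
structure DatumK₁ (P : ParamsK) where
  /-- number of completed renormalization steps -/
  k : ℕ
  /-- `e(L^kε)` -/
  eRun : ℝ
  /-- `λ(L^kε)` -/
  lamRun : ℝ
  eRun_pos : 0 < eRun
  lamRun_pos : 0 < lamRun
  /-- the print-strength amplitude of each generalized graph (one derivative leg per vertex) at each localization -/
  amp : ∀ {n m : ℕ} (G : Counts (Fin n) m) (κ : Fin m → ℚ), (∀ l, κ l ∈ P.menu) → LinesConnect G.src G.tgt → Single G →
    (Fin n → Fin (G.toModelK κ).d → ℕ) → IBPAmpK₁ G κ
  amp_k : ∀ {n m : ℕ} (G : Counts (Fin n) m) (κ : Fin m → ℚ) (hκ : ∀ l, κ l ∈ P.menu) (hG : LinesConnect G.src G.tgt)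
    (hs : Single G) (box : Fin n → Fin (G.toModelK κ).d → ℕ), (amp G κ hκ hG hs box).k = k
  amp_box : ∀ {n m : ℕ} (G : Counts (Fin n) m) (κ : Fin m → ℚ) (hκ : ∀ l, κ l ∈ P.menu) (hG : LinesConnect G.src G.tgt)
    (hs : Single G) (box : Fin n → Fin (G.toModelK κ).d → ℕ), (amp G κ hκ hG hs box).box = box
  amp_eRun : ∀ {n m : ℕ} (G : Counts (Fin n) m) (κ : Fin m → ℚ) (hκ : ∀ l, κ l ∈ P.menu) (hG : LinesConnect G.src G.tgt)
    (hs : Single G) (box : Fin n → Fin (G.toModelK κ).d → ℕ), (amp G κ hκ hG hs box).eRun = eRun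
  amp_lamRun : ∀ {n m : ℕ} (G : Counts (Fin n) m) (κ : Fin m → ℚ) (hκ : ∀ l, κ l ∈ P.menu) (hG : LinesConnect G.src G.tgt)
    (hs : Single G) (box : Fin n → Fin (G.toModelK κ).d → ℕ), (amp G κ hκ hG hs box).lamRun = lamRun
  /-- the orders do not depend on the localization -/
  amp_dv : ∀ {n m : ℕ} (G : Counts (Fin n) m) (κ : Fin m → ℚ) (hκ : ∀ l, κ l ∈ P.menu) (hG : LinesConnect G.src G.tgt)
    (hs : Single G) (box box' : Fin n → Fin (G.toModelK κ).d → ℕ), (amp G κ hκ hG hs box).dv = (amp G κ hκ hG hs box').dv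
  amp_ds : ∀ {n m : ℕ} (G : Counts (Fin n) m) (κ : Fin m → ℚ) (hκ : ∀ l, κ l ∈ P.menu) (hG : LinesConnect G.src G.tgt)
    (hs : Single G) (box box' : Fin n → Fin (G.toModelK κ).d → ℕ), (amp G κ hκ hG hs box).ds = (amp G κ hκ hG hs box').ds
  /-- the constants O(1) of (2.10)–(2.12) are bounded by `Cmax` -/
  amp_C_le : ∀ {n m : ℕ} (G : Counts (Fin n) m) (κ : Fin m → ℚ) (hκ : ∀ l, κ l ∈ P.menu) (hG : LinesConnect G.src G.tgt)
    (hs : Single G) (box : Fin n → Fin (G.toModelK κ).d → ℕ) (l : Fin m), (amp G κ hκ hG hs box).C l ≤ P.Cmax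
  /-- the constants of the differentiated vertex bounds are bounded by `CD` -/
  amp_cD_le : ∀ {n m : ℕ} (G : Counts (Fin n) m) (κ : Fin m → ℚ) (hκ : ∀ l, κ l ∈ P.menu) (hG : LinesConnect G.src G.tgt)
    (hs : Single G) (box : Fin n → Fin (G.toModelK κ).d → ℕ), (amp G κ hκ hG hs box).cD ≤ P.CD

/-- **The multi-graph expansion of r15's carrier for the generalized graphs, print-strength amplitudes** (as `expansionK` with the
datum's `IBPAmpK₁` amplitudes): graphs `CGraphK P mb`, `E` = total amplitude, `subDeg := degQK`, `Is24 := Is24K`.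
[cite: Balaban1983Higgs3, Prop. 2.2 p.428] -/
noncomputable def expansionK₁ (P : ParamsK) (mb : ℕ) (D : DatumK₁ P) : GraphExpansion where
  eRun := D.eRun
  lamRun := D.lamRun
  eRun_pos := D.eRun_pos
  lamRun_pos := D.lamRun_pos
  RenClass := CGraphK₁ P mb
  Loc := fun G => Fin G.n → Fin (G.G.toModelK G.κ).d → ℕ
  ExtS := Unit
  ExtV := Unit
  E := fun G box _ _ => (D.amp G.G G.κ G.κ_mem G.conn G.single box).toAmp.EtotM
  ds := fun G => ∑ v, (D.amp G.G G.κ G.κ_mem G.conn G.single box₀).ds v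
  dv := fun G => ∑ v, (D.amp G.G G.κ G.κ_mem G.conn G.single box₀).dv v
  treeLen := fun G box => boxTreeLen G.G.L D.k box
  treeLen_nonneg := fun G box => boxTreeLen_nonneg G.G.L D.k box
  normS := fun _ G box _ => ∏ v, (D.amp G.G G.κ G.κ_mem G.conn G.single box).NPhi v
  normV := fun _ G box _ => ∏ v, (D.amp G.G G.κ G.κ_mem G.conn G.single box).NA v
  normS_nonneg := fun _ G box _ => prod_nonneg fun v _ => (D.amp G.G G.κ G.κ_mem G.conn G.single box).NPhi_nonneg v
  normV_nonneg := fun _ G box _ => prod_nonneg fun v _ => (D.amp G.G G.κ G.κ_mem G.conn G.single box).NA_nonneg v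
  Graph := CGraphK₁ P mb
  single := id
  Connected := fun _ => True
  Sub := fun G => Component G.G
  subDeg := fun G H => degQK (relabelCounts G.G H.1) (G.κ ∘ H.1) H.2.1 H.2.2.1
  Is24 := fun G H => Is24K (relabelCounts G.G H.1) (G.κ ∘ H.1) H.2.1 H.2.2.1

/-- The family `fam n̄ D` of r15's `Prop22`/`Prop21` (print-strength amplitudes): at level `n̄` the generalized graphs have at most
`mbar n̄` lines. [cite: Balaban1983Higgs3, Prop. 2.2 p.428] -/
noncomputable def famK₁ (P : ParamsK) (mbar : ℕ → ℕ) : ℕ → DatumK₁ P → GraphExpansion :=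
  fun nbar D => expansionK₁ P (mbar nbar) D

/-- The printed hypothesis, read on the expansion: every component of every `G_i` along every ordering is a (2.4)-block of the
generalized graph or has positive (ℝ-valued) degree. [cite: Balaban1983Higgs3, Prop. 2.1 p.424] -/
theorem hyp_of_posSubgraphsExcept24K₁ {P : ParamsK} {mb : ℕ} {D : DatumK₁ P} {G : CGraphK₁ P mb}
    (h : PosSubgraphsExcept24 (expansionK₁ P mb D) G) (σ : Equiv.Perm (Fin G.m)) :
    ∀ i, i ≤ G.m → ∀ b ∈ ((relabelCounts G.G σ).toModelK (G.κ ∘ σ)).reps i,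
      ((relabelCounts G.G σ).toModelK (G.κ ∘ σ)).Nontriv i b →
      Is24K (relabelCounts G.G σ) (G.κ ∘ σ) i b ∨ 0 < ((relabelCounts G.G σ).toModelK (G.κ ∘ σ)).D i b := by
  intro i hi b hb hn
  rw [reps_toModelK] at hb
  rw [nontriv_toModelK] at hn
  have h' := h.2 ⟨σ, ⟨i, Nat.lt_succ_of_le hi⟩, ⟨b, hb, hn⟩⟩
  rcases h' with h24 | hpos
  · exact Or.inl h24
  · right
    have hc := cast_degQK (relabelCounts G.G σ) (G.κ ∘ σ) i b
    have : (0 : ℝ) < ((degQK (relabelCounts G.G σ) (G.κ ∘ σ) i b : ℚ) : ℝ) := by exact_mod_cast hpos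
    rw [hc] at this
    exact this

/-! ## Non-vacuity -/

/-- **A print-strength datum exists** (for `Cmax ≥ 0`, `CD ≥ 1`): the zero amplitudes over the graphs with one derivative leg per
vertex — the family `famK₁` is NOT vacuously indexed (contrast p19 gen 4's `datum_isEmpty`: a datum asked to serve graphs on which
the class is empty would be). [cite: Balaban1983Higgs3, Prop. 2.2 p.428] -/
noncomputable def DatumK₁.zero (P : ParamsK) (hC : 0 ≤ P.Cmax) (hD : 1 ≤ P.CD) : DatumK₁ P where
  k := 0
  eRun := 1
  lamRun := 1
  eRun_pos := one_pos
  lamRun_pos := one_pos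
  amp := fun G κ _ hG hs box => IBPAmpK₁.zero G κ hG hs 0 box
  amp_k := fun _ _ _ _ _ _ => rfl
  amp_box := fun _ _ _ _ _ _ => rfl
  amp_eRun := fun _ _ _ _ _ _ => rfl
  amp_lamRun := fun _ _ _ _ _ _ => rfl
  amp_dv := fun _ _ _ _ _ _ _ => rfl
  amp_ds := fun _ _ _ _ _ _ _ => rfl
  amp_C_le := fun _ _ _ _ _ _ _ => hC
  amp_cD_le := fun _ _ _ _ _ _ => hD

/-- The print-strength datum type is inhabited. [cite: Balaban1983Higgs3, Prop. 2.2 p.428] -/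
theorem datumK₁_nonempty (P : ParamsK) (hC : 0 ≤ P.Cmax) (hD : 1 ≤ P.CD) : Nonempty (DatumK₁ P) :=
  ⟨DatumK₁.zero P hC hD⟩

/-- A one-line graph (such as (2.4)) has one derivative leg per vertex trivially. [cite: Balaban1983Higgs3, (2.4) p.424] -/
theorem single_of_le_one {n m : ℕ} (G : Counts (Fin n) m) (hm : m ≤ 1) : Single G := by
  intro v l l' hne _
  exfalso
  apply hne
  apply Fin.ext
  have h1 := l.isLt
  have h2 := l'.isLt
  omega

/-! ## Proposition 2.2 at the print's strength -/

/-- **Proposition 2.1 with the (2.4) exception for the generalized graphs, print-strength readiness — r15's `B3Prop1.Prop21`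
INHABITED**: with `δ₀ := ½δ₁` (first) and, given α₀ and n̄, the single constant `O(1)(n̄) := unifO1K P (mbar n̄)`, (1.33) holds for
the class `{G}` of EVERY generalized graph with at most `mbar n̄` lines all of whose components have positive degree OR ARE
(2.4)-BLOCKS, for every print-strength datum, all localizations and all external-field data. [cite: Balaban1983Higgs3, Prop. 2.2 p.428] -/
theorem prop21_freeLines₁ (P : ParamsK) (mbar : ℕ → ℕ) : Prop21 (famK₁ P mbar) := by
  classical
  refine ⟨P.δ₁ / 2, half_pos P.δ₁_pos, fun α₀ _ _ nbar => ?_⟩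
  refine ⟨unifO1K P (mbar nbar), unifO1K_pos P (mbar nbar), fun D G hG => ?_⟩
  intro box Φ Aext
  change Fin G.n → Fin (G.G.toModelK G.κ).d → ℕ at box
  set A : IBPAmpK₁ G.G G.κ := D.amp G.G G.κ G.κ_mem G.conn G.single box with hA
  have hyp := fun σ => hyp_of_posSubgraphsExcept24K₁ hG σ
  have hfin : |A.toAmp.EtotM| ≤ unifO1K P (mbar nbar) * A.toAmp.prefM :=
    A.abs_EtotM_le_unifO1K P G.d_eq G.L_eq G.δ₁_eq G.m_le G.κ_mem
      (fun l => D.amp_C_le G.G G.κ G.κ_mem G.conn G.single box l) (D.amp_cD_le G.G G.κ G.κ_mem G.conn G.single box) hyp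
  show |A.toAmp.EtotM| ≤ unifO1K P (mbar nbar) * D.eRun ^ (∑ v, (D.amp G.G G.κ G.κ_mem G.conn G.single box₀).dv v)
      * D.lamRun ^ (∑ v, (D.amp G.G G.κ G.κ_mem G.conn G.single box₀).ds v)
      * Real.exp (-(P.δ₁ / 2 * boxTreeLen G.G.L D.k box)) * (∏ v, A.NPhi v) * (∏ v, A.NA v)
  have e : A.toAmp.prefM = D.eRun ^ (∑ v, (D.amp G.G G.κ G.κ_mem G.conn G.single box₀).dv v)
      * D.lamRun ^ (∑ v, (D.amp G.G G.κ G.κ_mem G.conn G.single box₀).ds v)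
      * Real.exp (-(P.δ₁ / 2 * boxTreeLen G.G.L D.k box)) * (∏ v, A.NPhi v) * (∏ v, A.NA v) := by
    have hb : A.box = box := D.amp_box G.G G.κ G.κ_mem G.conn G.single box
    have hk : A.k = D.k := D.amp_k G.G G.κ G.κ_mem G.conn G.single box
    have he : A.eRun = D.eRun := D.amp_eRun G.G G.κ G.κ_mem G.conn G.single box
    have hl : A.lamRun = D.lamRun := D.amp_lamRun G.G G.κ G.κ_mem G.conn G.single box
    have hdv : A.dv = (D.amp G.G G.κ G.κ_mem G.conn G.single box₀).dv := D.amp_dv G.G G.κ G.κ_mem G.conn G.single box box₀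
    have hds : A.ds = (D.amp G.G G.κ G.κ_mem G.conn G.single box₀).ds := D.amp_ds G.G G.κ G.κ_mem G.conn G.single box box₀
    have hδ : (G.G.toModelK G.κ).δ₀ = G.G.δ₁ / 2 := rfl
    have hL : (G.G.toModelK G.κ).L = G.G.L := rfl
    unfold Amp.prefM
    rw [hb, hk, he, hl, hdv, hds, hδ, hL, G.δ₁_eq]
  calc |A.toAmp.EtotM| ≤ unifO1K P (mbar nbar) * A.toAmp.prefM := hfin
    _ = _ := by rw [e]; ring

/-- **Proposition 2.2** p. 428 at the print's strength — r15's `B3Prop1.Prop22` INHABITED for the family of generalized expressions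
and graphs with print-strength IBP-ready amplitudes. [cite: Balaban1983Higgs3, Prop. 2.2 p.428] -/
theorem prop22_freeLines₁ (P : ParamsK) (mbar : ℕ → ℕ) : Prop22 (famK₁ P mbar) :=
  prop21_freeLines₁ P mbar

end B3FreeLine

end Literature.MathematicalPhysics.QuantumFieldTheory.Balaban1983to89
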